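import Literature.MathematicalPhysics.QuantumLattice.AnisotropicXYGaussianDomination
import Literature.Probability.LatticeModels.AnisotropicNVectorInfraredBound
import Mathlib.Algebra.QuadraticDiscriminant
import HarnessLib

/-!
# The ground-state infrared bound for the quantum XY model with direction-dependent couplings
# (Kennedy–Lieb–Shastry 1988, eqs. (6)–(7): the bound with `E^r_q`)

Topic `MathematicalPhysics/QuantumLattice`; sibling of `AnisotropicXYGaussianDomination.lean`
(Gaussian domination for `H_K = -Σ_xΣᵢ Kᵢ(S¹_xS¹_{x+eᵢ} + S²_xS²_{x+eᵢ})`) and of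
`XYOrderInfraredProofs.lean` (the isotropic chain (GD) ⇒ (A)). No named fact is introduced.

## What is printed

Kennedy, Lieb and Shastry, J. Stat. Phys. **53** (1988) 1019–1030, p. 1023: for the model (5) with
couplings `1, 1, r` in the three lattice directions, "we will show `0 ≤ g^r_q ≤ f^r_q, q ≠ Q` (6)
where `f^r_q = (e^r_0 E^r_q / 12E^r_{q-Q})^{1/2}`, `E^r_q = 2 - cos q₁ - cos q₂ + r(1 - cos q₃)` (7)";
p. 1026: "For the model (5) … the bound (14) holds with `E_{q-Q}` replaced by `E^r_{q-Q}`. The double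
commutator (13) equals `(2/3)[(2 - cos q₁ - cos q₂)ρ₁ + r(1 - cos q₃)ρ₃]` where `ρ₁` and `ρ₃` are the
expectations of `𝐒_x·𝐒_y` for bonds `{xy}` in the first and third lattice directions". For the XY
model (Kennedy–Lieb–Shastry, PRL **61** (1988) 2582, eq. (4): `g_q ≤ ½[(e₁E_q - e₃Σᵢcos qᵢ)/E_q]^{1/2}`,
"the proof of (4) in [the JSP paper] applies to the XY model") the same route with direction-dependent
couplings `K = (K₁,…,K_d) ≥ 0` and DIRECTION-RESOLVED bond correlations
`e_α^{(i)} = |Λ|⁻¹Σ_x ⟨S^α_xS^α_{x+eᵢ}⟩` (KLS's `ρ₁, ρ₃`, p. 1026) gives, for the tracial ground state of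
`H_K` on the even torus and every dual momentum `q` with `E^K_q = Σᵢ Kᵢ(1 - cos qᵢ) > 0`,

`0 ≤ ĝ¹_q`, `(ĝ¹_q)² E^K_q ≤ ¼ Σᵢ Kᵢ (e₁^{(i)} - e₃^{(i)} cos qᵢ)`     (`xyAniso_infraredBound_ground`),

the isotropic case `K ≡ 1` being the tree's `xy_infraredBound_of_groundEnergy_le` (there the `d`
directions are averaged using the lattice symmetry; here no symmetry between directions is used or
available).

## The proof (KLS's direct ground-state route, [KLS1988JSP] eqs. (12)–(14), (18)–(19))

* (GD_K) `E₀(H_K) ≤ E₀(H_K(h))` is the theorem `xyAniso_gaussianDomination_ground`; with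
  `H_K(th) = H_K - tV_K(h) + ½t²Q_K(h)` (`xyAnisoFieldHamiltonian_smul`) the abstract second-order
  perturbation lemma `Matrix.groundState_infraredBound_quadratic` applies;
* `V_K(cos(q·)) = 2E^K_q C_q`, `V_K(sin(q·)) = 2E^K_q D_q` (weighted discrete Laplacian of a plane
  wave, `xyAnisoGradField_cos/sin`), `Q_K(cos) + Q_K(sin) = 2E^K_q|Λ|`;
* the double commutator ([KLS1988JSP] (13), anisotropic form of p. 1026): for a wave `A = Σ a_xS¹_x`,
  `[A,[H_K,A]] = Σ_xΣᵢ Kᵢ((a_x² + a_{x+eᵢ}²)S²_xS²_{x+eᵢ} - 2a_xa_{x+eᵢ}S³_xS³_{x+eᵢ})`, whence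
  `Re ω([C,[H_K,C]]) + Re ω([D,[H_K,D]]) = 2|Λ|Σᵢ Kᵢ(e₂^{(i)} - cos qᵢ e₃^{(i)})`;
* `|Λ|ĝ¹_q = Re ω(C_q²) + Re ω(D_q²)`, the `U(1)` quarter turn (`e₂^{(i)} = e₁^{(i)}`), and the
  discriminant of the sum of the two quadratic inequalities.

## References

* [KLS1988JSP] T. Kennedy, E. H. Lieb, B. S. Shastry, J. Stat. Phys. 53 (1988) 1019–1030, eqs.
  (5)–(7) (p. 1023), (12)–(14) and the paragraph "For the model (5) …" (p. 1026), (18)–(19)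
  (read in: E. H. Lieb, *Statistical Mechanics (Selecta)*, paper IV.7).
* [KLS1988PRL] T. Kennedy, E. H. Lieb, B. S. Shastry, Phys. Rev. Lett. 61 (1988) 2582–2584, eq. (4).
* [DLS1978] F. J. Dyson, E. H. Lieb, B. Simon, J. Stat. Phys. 18 (1978) 335–383, §3 (the
  dispersion `E_p`, (44)).
-/

noncomputable section

open Matrix Finset
open scoped ComplexOrder
open Literature.MathematicalPhysics.QuantumLattice Literature.MathematicalPhysics.QuantumLattice.SpinOperators
  Literature.Probability.LatticeModels

namespace Literature.MathematicalPhysics.QuantumLattice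

variable {d : ℕ}

-- the commutator Lie-ring structure of an associative ring (Mathlib idiom, as in
-- `XYOrderInfraredProofs.lean`)
attribute [local instance 100] LieRing.ofAssociativeRing

/-! ### Ground-state correlations of the anisotropic model -/

section Observables

/-- The ground-state `α–α` correlation `G^α_K(x,y) = Re ω_K(S^α_xS^α_y)` in the tracial ground-state
functional of `H_K = xyAnisoTorus L n K` (junk `0` at `L = 0`); KLS's two-point function of the
model (5). [cite: KLS1988JSP, eqs. (5)–(6)] [cite: KLS1988PRL, before eq. (2)] -/
def xyAnisoGroundCorr (α : Fin 3) (L n : ℕ) (K : Fin d → ℝ) (x y : TorusSite d L) : ℝ :=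
  if hL : L = 0 then 0
  else
    haveI : NeZero L := ⟨hL⟩
    ((xyAnisoTorus L n K).groundStateFunctional (siteSpin n x α * siteSpin n y α)).re

/-- The ground-state structure factor `ĝ^α_q = |Λ|⁻¹Σ_{x,y} cos(q·(x-y)) G^α_K(x,y)` of the model (5)
(KLS's `g^r_q`; momenta indexed by the dual torus point `k`, `q = 2πk/L`; junk `0` at `L = 0`).
[cite: KLS1988JSP, eq. (6)] [cite: KLS1988PRL, before eq. (2)] -/
def xyAnisoStructureFactor (α : Fin 3) (L n : ℕ) (K : Fin d → ℝ) (k : TorusSite d L) : ℝ :=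
  if hL : L = 0 then 0
  else
    haveI : NeZero L := ⟨hL⟩
    (∑ x : TorusSite d L, ∑ y : TorusSite d L,
        Real.cos (torusPhase L k (x - y)) * xyAnisoGroundCorr α L n K x y) / (L : ℝ) ^ d

/-- **The direction-resolved nearest-neighbour correlation** `e_α^{(i)} = |Λ|⁻¹Σ_x G^α_K(x, x + eᵢ)`
— KLS's `ρ₁`, `ρ₃` ("the expectations of `𝐒_x·𝐒_y` for bonds `{xy}` in the first and third lattice
directions", p. 1026), per spin component; junk `0` at `L = 0`. [cite: KLS1988JSP, p. 1026] -/
def xyAnisoDirBondCorr (α : Fin 3) (L n : ℕ) (K : Fin d → ℝ) (i : Fin d) : ℝ :=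
  if hL : L = 0 then 0
  else
    haveI : NeZero L := ⟨hL⟩
    (∑ x : TorusSite d L, xyAnisoGroundCorr α L n K x (x + Pi.single i 1)) / (L : ℝ) ^ d

variable (L : ℕ) [NeZero L] (n : ℕ) (K : Fin d → ℝ)

/-- Unfolding on a genuine torus. [cite: KLS1988JSP, eq. (6)] -/
theorem xyAnisoGroundCorr_of_neZero (α : Fin 3) (x y : TorusSite d L) :
    xyAnisoGroundCorr α L n K x y =
      ((xyAnisoTorus L n K).groundStateFunctional (siteSpin n x α * siteSpin n y α)).re := by
  simp [xyAnisoGroundCorr, NeZero.ne L]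

/-- Unfolding on a genuine torus. [cite: KLS1988JSP, eq. (6)] -/
theorem xyAnisoStructureFactor_of_neZero (α : Fin 3) (k : TorusSite d L) :
    xyAnisoStructureFactor α L n K k =
      (∑ x : TorusSite d L, ∑ y : TorusSite d L,
        Real.cos (torusPhase L k (x - y)) * xyAnisoGroundCorr α L n K x y) / (L : ℝ) ^ d := by
  simp [xyAnisoStructureFactor, NeZero.ne L]

/-- Unfolding on a genuine torus. [cite: KLS1988JSP, p. 1026] -/
theorem xyAnisoDirBondCorr_of_neZero (α : Fin 3) (i : Fin d) :
    xyAnisoDirBondCorr α L n K i =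
      (∑ x : TorusSite d L, xyAnisoGroundCorr α L n K x (x + Pi.single i 1)) / (L : ℝ) ^ d := by
  simp [xyAnisoDirBondCorr, NeZero.ne L]

/-- `G^α_K(x,y) = G^α_K(y,x)` (the tracial ground state is Hermitian on products of Hermitian spins).
[cite: KLS1988JSP, eq. (6)] -/
theorem xyAnisoGroundCorr_symm (α : Fin 3) (x y : TorusSite d L) :
    xyAnisoGroundCorr α L n K x y = xyAnisoGroundCorr α L n K y x := by
  rw [xyAnisoGroundCorr_of_neZero, xyAnisoGroundCorr_of_neZero]
  have h : siteSpin n y α * siteSpin n x α =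
      (siteSpin n x α * siteSpin n y α : Op (TorusSite d L) (n + 1))ᴴ := by
    rw [conjTranspose_mul, (siteSpin_isHermitian n x α).eq, (siteSpin_isHermitian n y α).eq]
  rw [h, groundStateFunctional_conjTranspose_re]

/-- `Re ω_K` of the symmetrised bond is the two-point function. [cite: KLS1988JSP, eq. (6)] -/
theorem re_groundStateFunctional_aniso_spinBond (α : Fin 3) (x y : TorusSite d L) :
    ((xyAnisoTorus L n K).groundStateFunctional (spinBond n α x y)).re =
      xyAnisoGroundCorr α L n K x y := by
  rw [spinBond, LinearMap.map_smul, map_add, smul_eq_mul,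
    show (1 / 2 : ℂ) = ((1 / 2 : ℝ) : ℂ) by push_cast; ring, Complex.re_ofReal_mul,
    Complex.add_re, ← xyAnisoGroundCorr_of_neZero, ← xyAnisoGroundCorr_of_neZero,
    xyAnisoGroundCorr_symm L n K α y x]
  ring

/-- **(S_K) The `U(1)` symmetry**: `G²_K = G¹_K` — the global quarter turn about the `3`-axis commutes
with `H_K` (every bond `S¹S¹ + S²S²` is invariant) and the tracial ground state is invariant.
[cite: KLS1988PRL, after eq. (3) ("by symmetry")] [cite: KLS1988JSP, eq. (5)] -/
theorem xyAnisoGroundCorr_one_eq_zero (x y : TorusSite d L) :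
    xyAnisoGroundCorr 1 L n K x y = xyAnisoGroundCorr 0 L n K x y := by
  rw [xyAnisoGroundCorr_of_neZero, xyAnisoGroundCorr_of_neZero]
  set U : Op (TorusSite d L) (n + 1) :=
    productOp (fun _ : TorusSite d L => diagonal fun k : Fin (n + 1) => (-Complex.I) ^ (k : ℕ))
    with hU
  have hUU : Uᴴ * U = 1 := productOp_conjTranspose_mul fun _ => spinPhase_conjTranspose_mul n
  have hUU' : U * Uᴴ = 1 := productOp_mul_conjTranspose fun _ => spinPhase_mul_conjTranspose n
  -- `U H_K Uᴴ = H_K`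
  have hconj : U * xyAnisoTorus L n K * Uᴴ = xyAnisoTorus L n K := by
    rw [xyAnisoTorus, xyWeightedHamiltonian, Finset.mul_sum, Finset.sum_mul]
    refine sum_congr rfl fun e _ => ?_
    rw [Matrix.mul_smul, Matrix.smul_mul]
    congr 1
    induction e using Sym2.ind with
    | h x y =>
      simp only [Sym2.lift_mk, xyBond, Matrix.mul_neg, Matrix.neg_mul, Matrix.mul_add,
        Matrix.add_mul, hU, quarterTurn_conj_spinBond_zero, quarterTurn_conj_spinBond_one]
      abel
  have hcomm : U * xyAnisoTorus L n K = xyAnisoTorus L n K * U := by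
    have h2 : U * xyAnisoTorus L n K * Uᴴ * U = xyAnisoTorus L n K * U := by rw [hconj]
    rw [mul_assoc, hUU, mul_one] at h2
    exact h2
  have hinv := groundStateFunctional_conj_of_commute (xyAnisoTorus_isHermitian L n K) hcomm hUU
    (siteSpin n x 1 * siteSpin n y 1)
  rw [productOp_conj_mul (fun _ => spinPhase_conjTranspose_mul n),
    quarterTurn_conj_siteSpin_one, quarterTurn_conj_siteSpin_one] at hinv
  rw [hinv]

end Observables

/-! ### The field algebra of the anisotropic model -/

section FieldAlgebra

variable (L : ℕ) [NeZero L] (n : ℕ) (K : Fin d → ℝ)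

/-- `V_K(t h) = t V_K(h)`. [cite: KLS1988JSP, eq. (17)] -/
theorem xyAnisoGradField_smul (t : ℝ) (h : TorusSite d L → ℝ) :
    xyAnisoGradField L n K (t • h) = (t : ℂ) • xyAnisoGradField L n K h := by
  simp only [xyAnisoGradField, Pi.smul_apply, smul_eq_mul, smul_sum, smul_smul, ← mul_sub,
    Complex.ofReal_mul]
  refine sum_congr rfl fun x _ => sum_congr rfl fun i _ => ?_
  ring_nf

/-- `Q_K(t h) = t² Q_K(h)`. [cite: KLS1988JSP, eq. (17)] -/
theorem xyAnisoFieldEnergy_smul (t : ℝ) (h : TorusSite d L → ℝ) :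
    xyAnisoFieldEnergy L K (t • h) = t ^ 2 * xyAnisoFieldEnergy L K h := by
  simp only [xyAnisoFieldEnergy, Pi.smul_apply, smul_eq_mul, mul_sum, ← mul_sub, mul_pow]
  refine sum_congr rfl fun x _ => sum_congr rfl fun i _ => ?_
  ring

/-- `H_K(t h) = H_K + t(-V_K(h)) + ½t²Q_K(h)` (`L ≥ 3`): the form in which (GD_K) feeds
`Matrix.groundState_infraredBound_quadratic`. [cite: KLS1988JSP, eqs. (17)–(19)] -/
theorem xyAnisoFieldHamiltonian_smul (hL3 : 3 ≤ L) (t : ℝ) (h : TorusSite d L → ℝ) :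
    xyAnisoFieldHamiltonian L n K (t • h) =
      xyAnisoTorus L n K + (t : ℂ) • (-xyAnisoGradField L n K h) +
        ((t ^ 2 * xyAnisoFieldEnergy L K h / 2 : ℝ) : ℂ) • 1 := by
  rw [xyAnisoFieldHamiltonian_eq L n hL3, xyAnisoGradField_smul, xyAnisoFieldEnergy_smul, smul_neg,
    sub_eq_add_neg]

/-- Summation by parts, weighted: `V_K(h) = Σ_x (Σᵢ Kᵢ(2h_x - h_{x+eᵢ} - h_{x-eᵢ})) S¹_x`.
[cite: KLS1988JSP, eqs. (17), (19)] -/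
theorem xyAnisoGradField_eq_sum_laplacian (h : TorusSite d L → ℝ) :
    xyAnisoGradField L n K h = ∑ x : TorusSite d L,
      ((∑ i : Fin d, K i * (2 * h x - h (x + Pi.single i 1) - h (x - Pi.single i 1)) : ℝ) : ℂ) •
        siteSpin n x 0 := by
  have hL : xyAnisoGradField L n K h =
      (∑ x : TorusSite d L, ∑ i : Fin d,
          ((K i * (h x - h (x + Pi.single i 1)) : ℝ) : ℂ) • siteSpin n x 0) -
        ∑ x : TorusSite d L, ∑ i : Fin d,
          ((K i * (h x - h (x + Pi.single i 1)) : ℝ) : ℂ) • siteSpin n (x + Pi.single i 1) 0 := by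
    unfold xyAnisoGradField
    rw [← sum_sub_distrib]
    refine sum_congr rfl fun x _ => ?_
    rw [← sum_sub_distrib]
    exact sum_congr rfl fun i _ => smul_sub _ _ _
  have hre : ∀ i : Fin d, ∑ x : TorusSite d L,
      ((K i * (h x - h (x + Pi.single i 1)) : ℝ) : ℂ) • siteSpin n (x + Pi.single i 1) 0 =
        ∑ x : TorusSite d L, ((K i * (h (x - Pi.single i 1) - h x) : ℝ) : ℂ) • siteSpin n x 0 := by
    intro i
    rw [← (Equiv.subRight (Pi.single i (1 : ZMod L))).sum_comp]
    refine sum_congr rfl fun x _ => ?_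
    simp only [Equiv.subRight_apply, sub_add_cancel]
  have h2 : ∑ x : TorusSite d L, ∑ i : Fin d,
      ((K i * (h x - h (x + Pi.single i 1)) : ℝ) : ℂ) • siteSpin n (x + Pi.single i 1) 0 =
        ∑ x : TorusSite d L, ∑ i : Fin d,
          ((K i * (h (x - Pi.single i 1) - h x) : ℝ) : ℂ) • siteSpin n x 0 := by
    rw [sum_comm, sum_congr rfl fun i _ => hre i, sum_comm]
  rw [hL, h2, ← sum_sub_distrib]
  refine sum_congr rfl fun x _ => ?_
  rw [← sum_sub_distrib, Complex.ofReal_sum, sum_smul]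
  refine sum_congr rfl fun i _ => ?_
  rw [← sub_smul, ← Complex.ofReal_sub]
  congr 1
  push_cast
  ring

/-- The weighted discrete Laplacian of the cosine wave, direction by direction:
`Σᵢ Kᵢ(2cos(q·x) - cos(q·(x+eᵢ)) - cos(q·(x-eᵢ))) = 2E^K_q cos(q·x)`, `E^K_q = ΣᵢKᵢ(1 - cos qᵢ)`.
[cite: KLS1988JSP, eq. (7)] [cite: DysonLiebSimon1978, §3] -/
theorem anisoLaplacian_cos_torusPhase (q x : TorusSite d L) :
    ∑ i : Fin d, K i * (2 * Real.cos (torusPhase L q x) - Real.cos (torusPhase L q (x + Pi.single i 1)) -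
      Real.cos (torusPhase L q (x - Pi.single i 1))) =
      2 * NVectorAniso.anisoDispersion K (latticeMomentum L q) * Real.cos (torusPhase L q x) := by
  rw [NVectorAniso.anisoDispersion, mul_sum, sum_mul]
  refine sum_congr rfl fun i _ => ?_
  have h := cos_torusPhase_mul_cos_latticeMomentum L q x i
  linear_combination (2 * K i) * h

/-- The weighted discrete Laplacian of the sine wave. [cite: KLS1988JSP, eq. (7)] -/
theorem anisoLaplacian_sin_torusPhase (q x : TorusSite d L) :
    ∑ i : Fin d, K i * (2 * Real.sin (torusPhase L q x) - Real.sin (torusPhase L q (x + Pi.single i 1)) -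
      Real.sin (torusPhase L q (x - Pi.single i 1))) =
      2 * NVectorAniso.anisoDispersion K (latticeMomentum L q) * Real.sin (torusPhase L q x) := by
  rw [NVectorAniso.anisoDispersion, mul_sum, sum_mul]
  refine sum_congr rfl fun i _ => ?_
  have h := sin_torusPhase_mul_cos_latticeMomentum L q x i
  linear_combination (2 * K i) * h

/-- **`V_K(cos(q·)) = 2E^K_q C_q`.** [cite: KLS1988JSP, eqs. (7), (19)] -/
theorem xyAnisoGradField_cos (q : TorusSite d L) :
    xyAnisoGradField L n K (fun x => Real.cos (torusPhase L q x)) =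
      ((2 * NVectorAniso.anisoDispersion K (latticeMomentum L q) : ℝ) : ℂ) • xyCosMode L n q := by
  rw [xyAnisoGradField_eq_sum_laplacian, xyCosMode, smul_sum]
  refine sum_congr rfl fun x _ => ?_
  rw [anisoLaplacian_cos_torusPhase, smul_smul, ← Complex.ofReal_mul]

/-- **`V_K(sin(q·)) = 2E^K_q D_q`.** [cite: KLS1988JSP, eqs. (7), (19)] -/
theorem xyAnisoGradField_sin (q : TorusSite d L) :
    xyAnisoGradField L n K (fun x => Real.sin (torusPhase L q x)) =
      ((2 * NVectorAniso.anisoDispersion K (latticeMomentum L q) : ℝ) : ℂ) • xySinMode L n q := by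
  rw [xyAnisoGradField_eq_sum_laplacian, xySinMode, smul_sum]
  refine sum_congr rfl fun x _ => ?_
  rw [anisoLaplacian_sin_torusPhase, smul_smul, ← Complex.ofReal_mul]

omit [NeZero L] in
/-- **`Q_K(cos(q·)) + Q_K(sin(q·)) = 2E^K_q |Λ|`**: `(c_x - c_y)² + (s_x - s_y)² = 2 - 2cos(q·(x-y))`
and `cos(q·(-eᵢ)) = cos qᵢ`. [cite: KLS1988JSP, eq. (7)] [cite: DysonLiebSimon1978, §3] -/
theorem xyAnisoFieldEnergy_cos_add_sin [NeZero L] (q : TorusSite d L) :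
    xyAnisoFieldEnergy L K (fun x => Real.cos (torusPhase L q x)) +
        xyAnisoFieldEnergy L K (fun x => Real.sin (torusPhase L q x)) =
      2 * NVectorAniso.anisoDispersion K (latticeMomentum L q) * (L : ℝ) ^ d := by
  unfold xyAnisoFieldEnergy
  rw [← sum_add_distrib]
  have hx : ∀ x : TorusSite d L, (∑ i : Fin d, K i * (Real.cos (torusPhase L q x) -
      Real.cos (torusPhase L q (x + Pi.single i 1))) ^ 2 +
      ∑ i : Fin d, K i * (Real.sin (torusPhase L q x) - Real.sin (torusPhase L q (x + Pi.single i 1))) ^ 2)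
      = 2 * NVectorAniso.anisoDispersion K (latticeMomentum L q) := by
    intro x
    rw [← sum_add_distrib, NVectorAniso.anisoDispersion, mul_sum]
    refine sum_congr rfl fun i _ => ?_
    have h1 := cos_sq_add_sin_sq_torusPhase L q x
    have h2 := cos_sq_add_sin_sq_torusPhase L q (x + Pi.single i 1)
    have h3 := cos_torusPhase_sub L q x (x + Pi.single i 1)
    rw [sub_add_cancel_left, cos_torusPhase_neg_single] at h3
    linear_combination (K i) * h1 + (K i) * h2 + (2 * K i) * h3
  rw [sum_congr rfl fun x _ => hx x, sum_const, card_univ, nsmul_eq_mul, Fintype.card_pi,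
    prod_const, ZMod.card, card_univ, Fintype.card_fin, Nat.cast_pow]
  ring

end FieldAlgebra

/-! ### The double commutator `[A, [H_K, A]]` ([KLS1988JSP] eq. (13), anisotropic form of p. 1026) -/

section DoubleCommutator

variable (L : ℕ) [NeZero L] (n : ℕ) (K : Fin d → ℝ)

/-- Linearity of the double commutator in the Hamiltonian: `⁅A,⁅H_K,A⁆⁆ = -Σ_xΣᵢ Kᵢ ⁅A,⁅B_{x,x+eᵢ},A⁆⁆`
with `B = xyBond` (`L ≥ 3`). [cite: KLS1988JSP, eq. (13)] -/
private theorem lie_lie_xyAnisoTorus_eq_sum (hL3 : 3 ≤ L) (A : Op (TorusSite d L) (n + 1)) :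
    ⁅A, ⁅xyAnisoTorus L n K, A⁆⁆ =
      -∑ x : TorusSite d L, ∑ i : Fin d, ((K i : ℝ) : ℂ) • ⁅A, ⁅xyBond n x (x + Pi.single i 1), A⁆⁆ := by
  rw [xyAnisoTorus_eq_sum L n hL3, neg_lie, lie_neg, sum_lie univ _ A, lie_sum univ _ A]
  congr 1
  refine sum_congr rfl fun x _ => ?_
  rw [sum_lie univ _ A, lie_sum univ _ A]
  refine sum_congr rfl fun i _ => ?_
  rw [smul_lie, lie_smul]

/-- **The double commutator of `H_K` with a wave of the first component**: for
`A = Σ_u a_u S¹_u`, `[A, [H_K, A]] = Σ_x Σᵢ Kᵢ((a_x² + a_{x+eᵢ}²) S²_xS²_{x+eᵢ} - 2a_xa_{x+eᵢ} S³_xS³_{x+eᵢ})`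
(`L ≥ 3`). [cite: KLS1988JSP, eq. (13), p. 1026] -/
theorem lie_lie_xyAnisoTorus (hL3 : 3 ≤ L) (a : TorusSite d L → ℂ) :
    ⁅(∑ u : TorusSite d L, a u • (siteSpin n u 0 : Op (TorusSite d L) (n + 1))),
      ⁅xyAnisoTorus L n K, ∑ u : TorusSite d L, a u • (siteSpin n u 0 : Op (TorusSite d L) (n + 1))⁆⁆ =
      ∑ x : TorusSite d L, ∑ i : Fin d, ((K i : ℝ) : ℂ) •
        ((a x ^ 2 + a (x + Pi.single i 1) ^ 2) •
            (siteSpin n x 1 * siteSpin n (x + Pi.single i 1) 1 : Op (TorusSite d L) (n + 1)) -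
          (2 * a x * a (x + Pi.single i 1)) •
            (siteSpin n x 2 * siteSpin n (x + Pi.single i 1) 2 : Op (TorusSite d L) (n + 1))) := by
  rw [lie_lie_xyAnisoTorus_eq_sum L n K hL3, ← Finset.sum_neg_distrib]
  refine sum_congr rfl fun x _ => ?_
  rw [← Finset.sum_neg_distrib]
  refine sum_congr rfl fun i _ => ?_
  have hxy : x ≠ x + Pi.single i 1 := by
    intro h
    exact single_ne_zero_of_two_le L (by omega) i (left_eq_add.1 h)
  rw [xyBond, spinBond_eq_mul_of_ne hxy 0, spinBond_eq_mul_of_ne hxy 1, lie_lie_bond a hxy]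
  module

/-- The ground-state expectation of the double commutator, bond by bond:
`Re ω_K([A,[H_K,A]]) = Σ_xΣᵢ Kᵢ((a_x² + a_{x+eᵢ}²)G²_K(x,x+eᵢ) - 2a_xa_{x+eᵢ}G³_K(x,x+eᵢ))` for a
real wave. [cite: KLS1988JSP, eq. (13), p. 1026] -/
theorem re_groundStateFunctional_aniso_lie_lie (hL3 : 3 ≤ L) (a : TorusSite d L → ℝ) :
    ((xyAnisoTorus L n K).groundStateFunctional
      ⁅(∑ u : TorusSite d L, (a u : ℂ) • (siteSpin n u 0 : Op (TorusSite d L) (n + 1))),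
        ⁅xyAnisoTorus L n K,
          ∑ u : TorusSite d L, (a u : ℂ) • (siteSpin n u 0 : Op (TorusSite d L) (n + 1))⁆⁆).re =
      ∑ x : TorusSite d L, ∑ i : Fin d, K i *
        ((a x ^ 2 + a (x + Pi.single i 1) ^ 2) * xyAnisoGroundCorr 1 L n K x (x + Pi.single i 1) -
          2 * a x * a (x + Pi.single i 1) * xyAnisoGroundCorr 2 L n K x (x + Pi.single i 1)) := by
  rw [lie_lie_xyAnisoTorus L n K hL3, map_sum, Complex.re_sum]
  refine sum_congr rfl fun x _ => ?_
  rw [map_sum, Complex.re_sum]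
  refine sum_congr rfl fun i _ => ?_
  rw [LinearMap.map_smul, smul_eq_mul, Complex.re_ofReal_mul, map_sub, LinearMap.map_smul,
    LinearMap.map_smul, smul_eq_mul, smul_eq_mul, Complex.sub_re,
    show ((a x : ℂ) ^ 2 + (a (x + Pi.single i 1) : ℂ) ^ 2) =
      ((a x ^ 2 + a (x + Pi.single i 1) ^ 2 : ℝ) : ℂ) by push_cast; ring,
    show (2 * (a x : ℂ) * (a (x + Pi.single i 1) : ℂ)) =
      ((2 * a x * a (x + Pi.single i 1) : ℝ) : ℂ) by push_cast; ring,
    Complex.re_ofReal_mul, Complex.re_ofReal_mul, ← xyAnisoGroundCorr_of_neZero,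
    ← xyAnisoGroundCorr_of_neZero]

/-- **The two modes together** (`L ≥ 3`):
`Re ω_K([C_q,[H_K,C_q]]) + Re ω_K([D_q,[H_K,D_q]]) = 2Σᵢ Kᵢ Σ_z (G²_K(z,z+eᵢ) - cos qᵢ G³_K(z,z+eᵢ))`
— KLS's "(2/3)[(2 - cos q₁ - cos q₂)ρ₁ + r(1 - cos q₃)ρ₃]" in the XY setting, before the symmetry
step. [cite: KLS1988JSP, eq. (13), p. 1026] [cite: KLS1988PRL, eq. (4)] -/
theorem re_groundStateFunctional_aniso_lie_lie_modes (hL3 : 3 ≤ L) (q : TorusSite d L) :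
    ((xyAnisoTorus L n K).groundStateFunctional
        ⁅xyCosMode L n q, ⁅xyAnisoTorus L n K, xyCosMode L n q⁆⁆).re +
      ((xyAnisoTorus L n K).groundStateFunctional
        ⁅xySinMode L n q, ⁅xyAnisoTorus L n K, xySinMode L n q⁆⁆).re =
      2 * ∑ i : Fin d, K i * ∑ z : TorusSite d L,
        (xyAnisoGroundCorr 1 L n K z (z + Pi.single i 1) -
          Real.cos (latticeMomentum L q i) * xyAnisoGroundCorr 2 L n K z (z + Pi.single i 1)) := by
  rw [xyCosMode, xySinMode, re_groundStateFunctional_aniso_lie_lie L n K hL3,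
    re_groundStateFunctional_aniso_lie_lie L n K hL3, ← sum_add_distrib, mul_sum]
  simp_rw [← sum_add_distrib]
  rw [sum_comm]
  refine sum_congr rfl fun i _ => ?_
  rw [← mul_assoc, mul_sum]
  refine sum_congr rfl fun z _ => ?_
  have h1 := cos_sq_add_sin_sq_torusPhase L q z
  have h2 := cos_sq_add_sin_sq_torusPhase L q (z + Pi.single i 1)
  have h3 := cos_torusPhase_sub L q z (z + Pi.single i 1)
  rw [sub_add_cancel_left, cos_torusPhase_neg_single] at h3
  set G1 := xyAnisoGroundCorr 1 L n K z (z + Pi.single i 1)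
  set G2 := xyAnisoGroundCorr 2 L n K z (z + Pi.single i 1)
  linear_combination (K i * G1) * h1 + (K i * G1) * h2 + (2 * K i * G2) * h3

end DoubleCommutator

/-! ### The structure factor through the two modes -/

section StructureFactor

variable (L : ℕ) [NeZero L] (n : ℕ) (K : Fin d → ℝ)

/-- `ω(A_a A_b) = Σ_{x,y} a_x b_y ω(S¹_x S¹_y)` for real coefficient families, in the tracial ground
state of any Hamiltonian. [folklore] -/
private theorem groundStateFunctional_wave_mul_wave' (A : Op (TorusSite d L) (n + 1))
    (a b : TorusSite d L → ℝ) :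
    A.groundStateFunctional
        ((∑ x : TorusSite d L, (a x : ℂ) • siteSpin n x 0) *
          ∑ y : TorusSite d L, (b y : ℂ) • siteSpin n y 0) =
      ∑ x : TorusSite d L, ∑ y : TorusSite d L, ((a x * b y : ℝ) : ℂ) *
        A.groundStateFunctional (siteSpin n x 0 * siteSpin n y 0) := by
  rw [sum_mul_sum, map_sum]
  refine sum_congr rfl fun x _ => ?_
  rw [map_sum]
  refine sum_congr rfl fun y _ => ?_
  rw [smul_mul_assoc, mul_smul_comm, smul_smul, LinearMap.map_smul, smul_eq_mul,
    Complex.ofReal_mul]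

/-- **The structure factor through the modes**: `|Λ| ĝ¹_K(q) = Re ω_K(C_q²) + Re ω_K(D_q²)`.
[cite: KLS1988JSP, eq. (6)] [cite: KLS1988PRL, before eq. (2)] -/
theorem xyAnisoStructureFactor_eq_modes (q : TorusSite d L) :
    xyAnisoStructureFactor 0 L n K q * (L : ℝ) ^ d =
      ((xyAnisoTorus L n K).groundStateFunctional (xyCosMode L n q * xyCosMode L n q)).re +
        ((xyAnisoTorus L n K).groundStateFunctional (xySinMode L n q * xySinMode L n q)).re := by
  have hL : (0 : ℝ) < (L : ℝ) ^ d := by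
    have : (0 : ℝ) < L := by exact_mod_cast Nat.pos_of_ne_zero (NeZero.ne L)
    positivity
  rw [xyAnisoStructureFactor_of_neZero, div_mul_cancel₀ _ hL.ne', xyCosMode, xySinMode,
    groundStateFunctional_wave_mul_wave', groundStateFunctional_wave_mul_wave', Complex.re_sum,
    Complex.re_sum, ← sum_add_distrib]
  refine sum_congr rfl fun x _ => ?_
  rw [Complex.re_sum, Complex.re_sum, ← sum_add_distrib]
  refine sum_congr rfl fun y _ => ?_
  rw [Complex.re_ofReal_mul, Complex.re_ofReal_mul, xyAnisoGroundCorr_of_neZero, cos_torusPhase_sub]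
  ring

end StructureFactor

/-! ### Assembly: (GD_K) ⇒ the anisotropic infrared bound -/

section Assembly

variable (L : ℕ) [NeZero L] (n : ℕ) (K : Fin d → ℝ)

/-- **One mode.** If `E₀(H_K) ≤ E₀(H_K(h))` for all fields and `V_K(h) = rW` with `r ≠ 0`, `W`
Hermitian, then `0 ≤ ½r⁻²Q_K(h) + 2μ Re ω_K(W²) + μ² Re ω_K(W(H_K - E₀)W)` for all real `μ`
(`L ≥ 3`). [cite: KLS1988JSP, eqs. (18)–(19)] -/
theorem xyAniso_modeQuadratic_nonneg (hL3 : 3 ≤ L)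
    (hGD : ∀ h : TorusSite d L → ℝ,
      (xyAnisoTorus L n K).groundEnergy ≤ (xyAnisoFieldHamiltonian L n K h).groundEnergy)
    {h : TorusSite d L → ℝ} {W : Op (TorusSite d L) (n + 1)} (hW : W.IsHermitian) {r : ℝ}
    (hVh : xyAnisoGradField L n K h = (r : ℂ) • W) (hr : r ≠ 0) (μ : ℝ) :
    0 ≤ r⁻¹ ^ 2 * xyAnisoFieldEnergy L K h / 2 +
      2 * μ * ((xyAnisoTorus L n K).groundStateFunctional (W * W)).re +
      μ ^ 2 * ((xyAnisoTorus L n K).groundStateFunctional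
        (W * (xyAnisoTorus L n K - ((xyAnisoTorus L n K).groundEnergy : ℂ) • 1) * W)).re := by
  have hV : xyAnisoGradField L n K (r⁻¹ • h) = W := by
    rw [xyAnisoGradField_smul, hVh, smul_smul, ← Complex.ofReal_mul, inv_mul_cancel₀ hr,
      Complex.ofReal_one, one_smul]
  have hQ : xyAnisoFieldEnergy L K (r⁻¹ • h) = r⁻¹ ^ 2 * xyAnisoFieldEnergy L K h :=
    xyAnisoFieldEnergy_smul L K r⁻¹ h
  have key := Matrix.groundState_infraredBound_quadratic (xyAnisoTorus_isHermitian L n K) hW.neg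
    (Q := r⁻¹ ^ 2 * xyAnisoFieldEnergy L K h) (fun t => by
      have ht := hGD (t • (r⁻¹ • h))
      rwa [xyAnisoFieldHamiltonian_smul L n K hL3, hV, hQ] at ht) μ
  simpa only [neg_mul, mul_neg, neg_neg] using key

/-- `Re ω(W(H - E₀)W) = ½ Re ω([W,[H,W]])` in the tracial ground state of a Hermitian `H`.
[cite: KLS1988JSP, eqs. (12)–(13)] -/
theorem re_groundStateFunctional_conj_eq_lie_lie' {m : Type*} [Fintype m] [DecidableEq m]
    {H : Matrix m m ℂ} (hH : H.IsHermitian) (W : Matrix m m ℂ) :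
    (H.groundStateFunctional (W * (H - (H.groundEnergy : ℂ) • 1) * W)).re =
      (H.groundStateFunctional ⁅W, ⁅H, W⁆⁆).re / 2 := by
  rw [Matrix.groundStateFunctional_mul_sub_groundEnergy_mul hH W,
    show (⁅W, ⁅H, W⁆⁆ : Matrix m m ℂ) = W * (H * W) - W * (W * H) - (H * W * W - W * (H * W)) by
      simp only [Ring.lie_def, mul_sub, sub_mul, mul_assoc]]
  simp only [Complex.mul_re, one_div, Complex.inv_re, Complex.inv_im]
  norm_num
  ring

/-- **(GD_K) ⇒ the anisotropic infrared bound, in finite volume.** For `L ≥ 3`, every spin, every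
`K` and every dual momentum `q` with `E^K_q > 0`: if `E₀(H_K) ≤ E₀(H_K(h))` for all real fields `h`,
then `0 ≤ ĝ¹_K(q)` and `(ĝ¹_K(q))² E^K_q ≤ ¼ Σᵢ Kᵢ (e₁^{(i)} - e₃^{(i)} cos qᵢ)` — KLS's (6)–(7) with
the double commutator of p. 1026 and `e₂^{(i)} = e₁^{(i)}`, in the XY form of [KLS1988PRL] eq. (4).
[cite: KLS1988JSP, eqs. (6)–(7), (12)–(14), p. 1026] [cite: KLS1988PRL, eq. (4)] -/
theorem xyAniso_infraredBound_of_groundEnergy_le (hL3 : 3 ≤ L)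
    (hGD : ∀ h : TorusSite d L → ℝ,
      (xyAnisoTorus L n K).groundEnergy ≤ (xyAnisoFieldHamiltonian L n K h).groundEnergy)
    (q : TorusSite d L) (hq : 0 < NVectorAniso.anisoDispersion K (latticeMomentum L q)) :
    0 ≤ xyAnisoStructureFactor 0 L n K q ∧
      xyAnisoStructureFactor 0 L n K q ^ 2 * NVectorAniso.anisoDispersion K (latticeMomentum L q) ≤
        (1 / 4 : ℝ) * ∑ i, K i * (xyAnisoDirBondCorr 0 L n K i -
          xyAnisoDirBondCorr 2 L n K i * Real.cos (latticeMomentum L q i)) := by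
  -- notation
  set H : Op (TorusSite d L) (n + 1) := xyAnisoTorus L n K with hH_def
  have hH : H.IsHermitian := xyAnisoTorus_isHermitian L n K
  set E : ℝ := NVectorAniso.anisoDispersion K (latticeMomentum L q) with hE_def
  have hE : 0 < E := hq
  set C : Op (TorusSite d L) (n + 1) := xyCosMode L n q with hC_def
  set D : Op (TorusSite d L) (n + 1) := xySinMode L n q with hD_def
  set Kop : Op (TorusSite d L) (n + 1) := H - (H.groundEnergy : ℂ) • 1 with hK_def
  set aC : ℝ := (H.groundStateFunctional (C * C)).re with haC_def
  set aD : ℝ := (H.groundStateFunctional (D * D)).re with haD_def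
  set bC : ℝ := (H.groundStateFunctional (C * Kop * C)).re with hbC_def
  set bD : ℝ := (H.groundStateFunctional (D * Kop * D)).re with hbD_def
  set Qc : ℝ := xyAnisoFieldEnergy L K (fun x => Real.cos (torusPhase L q x)) with hQc_def
  set Qs : ℝ := xyAnisoFieldEnergy L K (fun x => Real.sin (torusPhase L q x)) with hQs_def
  have hLd : 0 < (L : ℝ) ^ d := by
    have : (0 : ℝ) < L := by exact_mod_cast Nat.pos_of_ne_zero (NeZero.ne L)
    positivity
  set Sg : ℝ := ∑ i, K i * (xyAnisoDirBondCorr 0 L n K i -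
    xyAnisoDirBondCorr 2 L n K i * Real.cos (latticeMomentum L q i)) with hSg_def
  have h2E : (2 * E) ≠ 0 := by positivity
  -- the two quadratic inequalities
  have hquadC : ∀ μ : ℝ, 0 ≤ (2 * E)⁻¹ ^ 2 * Qc / 2 + 2 * μ * aC + μ ^ 2 * bC := fun μ =>
    xyAniso_modeQuadratic_nonneg L n K hL3 hGD (xyCosMode_isHermitian L n q)
      (xyAnisoGradField_cos L n K q) h2E μ
  have hquadS : ∀ μ : ℝ, 0 ≤ (2 * E)⁻¹ ^ 2 * Qs / 2 + 2 * μ * aD + μ ^ 2 * bD := fun μ =>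
    xyAniso_modeQuadratic_nonneg L n K hL3 hGD (xySinMode_isHermitian L n q)
      (xyAnisoGradField_sin L n K q) h2E μ
  -- their sum and its discriminant
  have hQsum : (2 * E)⁻¹ ^ 2 * Qc / 2 + (2 * E)⁻¹ ^ 2 * Qs / 2 = (L : ℝ) ^ d / (4 * E) := by
    have h := xyAnisoFieldEnergy_cos_add_sin L K q
    rw [← hQc_def, ← hQs_def, ← hE_def] at h
    rw [show (2 * E)⁻¹ ^ 2 * Qc / 2 + (2 * E)⁻¹ ^ 2 * Qs / 2 = (2 * E)⁻¹ ^ 2 * (Qc + Qs) / 2 by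
      ring, h]
    field_simp
    ring
  have hdisc : (aC + aD) ^ 2 ≤ (bC + bD) * ((L : ℝ) ^ d / (4 * E)) := by
    have hq' : ∀ x : ℝ, 0 ≤ (bC + bD) * (x * x) + 2 * (aC + aD) * x + (L : ℝ) ^ d / (4 * E) := by
      intro x
      have h1 := hquadC x
      have h2 := hquadS x
      rw [← hQsum]
      linarith [h1, h2]
    have hd' := discrim_le_zero hq'
    rw [discrim] at hd'
    nlinarith [hd']
  -- `A = |Λ| ĝ`
  have hA : xyAnisoStructureFactor 0 L n K q * (L : ℝ) ^ d = aC + aD :=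
    xyAnisoStructureFactor_eq_modes L n K q
  -- `B = |Λ| Σᵢ Kᵢ (e₁⁽ⁱ⁾ - e₃⁽ⁱ⁾ cos qᵢ)`
  have hB : bC + bD = (L : ℝ) ^ d * Sg := by
    rw [hbC_def, hbD_def, re_groundStateFunctional_conj_eq_lie_lie' hH C,
      re_groundStateFunctional_conj_eq_lie_lie' hH D, ← add_div,
      re_groundStateFunctional_aniso_lie_lie_modes L n K hL3 q, mul_div_cancel_left₀ _ two_ne_zero,
      hSg_def, mul_sum]
    refine sum_congr rfl fun i _ => ?_
    simp only [xyAnisoGroundCorr_one_eq_zero L n K]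
    rw [sum_sub_distrib, ← mul_sum, xyAnisoDirBondCorr_of_neZero, xyAnisoDirBondCorr_of_neZero]
    field_simp
  -- positivity of `A`
  have haC : 0 ≤ aC := re_groundStateFunctional_mul_self_nonneg H (xyCosMode_isHermitian L n q)
  have haD : 0 ≤ aD := re_groundStateFunctional_mul_self_nonneg H (xySinMode_isHermitian L n q)
  have hg0 : 0 ≤ xyAnisoStructureFactor 0 L n K q := by
    have h0 : 0 ≤ xyAnisoStructureFactor 0 L n K q * (L : ℝ) ^ d := by
      rw [hA]; exact add_nonneg haC haD
    exact nonneg_of_mul_nonneg_left h0 hLd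
  refine ⟨hg0, ?_⟩
  rw [hB, ← hA] at hdisc
  have h1 : xyAnisoStructureFactor 0 L n K q ^ 2 * (4 * E) * ((L : ℝ) ^ d) ^ 2 ≤
      Sg * ((L : ℝ) ^ d) ^ 2 := by
    have h4E : 0 < 4 * E := by positivity
    have := mul_le_mul_of_nonneg_right hdisc h4E.le
    calc xyAnisoStructureFactor 0 L n K q ^ 2 * (4 * E) * ((L : ℝ) ^ d) ^ 2
        = (xyAnisoStructureFactor 0 L n K q * (L : ℝ) ^ d) ^ 2 * (4 * E) := by ring
      _ ≤ (L : ℝ) ^ d * Sg * ((L : ℝ) ^ d / (4 * E)) * (4 * E) := this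
      _ = Sg * ((L : ℝ) ^ d) ^ 2 := by field_simp
  have h2 : xyAnisoStructureFactor 0 L n K q ^ 2 * (4 * E) ≤ Sg :=
    le_of_mul_le_mul_right h1 (by positivity)
  linarith [h2]

/-- `E^K_q > 0` for `K > 0` componentwise and `q ≠ 0` (`E^K_q ≥ (minᵢ Kᵢ)·E_q`). [cite: KLS1988JSP, eq. (7)] -/
theorem anisoDispersion_latticeMomentum_pos {K : Fin d → ℝ} (hK : ∀ i, 0 < K i) {q : TorusSite d L}
    (hq : q ≠ 0) : 0 < NVectorAniso.anisoDispersion K (latticeMomentum L q) := by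
  obtain ⟨i, hi⟩ : ∃ i, q i ≠ 0 := Function.ne_iff.mp hq
  rw [NVectorAniso.anisoDispersion]
  have hterm : ∀ j, 0 ≤ K j * (1 - Real.cos (latticeMomentum L q j)) := fun j =>
    mul_nonneg (hK j).le (sub_nonneg.2 (Real.cos_le_one _))
  refine lt_of_lt_of_le ?_ (Finset.single_le_sum (fun j _ => hterm j) (mem_univ i))
  refine mul_pos (hK i) (sub_pos.2 ?_)
  -- `cos qᵢ < 1` for `qᵢ ≠ 0`: `qᵢ = 2π kᵢ/L` with `0 < kᵢ < L`
  have hsingle : dispersion (latticeMomentum L (Pi.single i (q i))) > 0 :=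
    dispersion_latticeMomentum_pos (by
      intro h
      apply hi
      have := congrFun h i
      rwa [Pi.single_eq_same, Pi.zero_apply] at this)
  rw [dispersion] at hsingle
  have hsum : ∑ j : Fin d, (1 - Real.cos (latticeMomentum L (Pi.single i (q i)) j)) =
      1 - Real.cos (latticeMomentum L q i) := by
    rw [Finset.sum_eq_single i]
    · simp [latticeMomentum]
    · intro j _ hj
      simp [latticeMomentum, Pi.single_eq_of_ne hj]
    · intro h; exact absurd (mem_univ i) h
  rw [hsum] at hsingle
  linarith

/-- **The anisotropic Kennedy–Lieb–Shastry infrared bound (ground state).** For the quantum XY model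
with direction-dependent couplings `K > 0` (every `d`, every spin `n/2`) on the even torus of side
`L ≥ 4`, and every dual momentum `q ≠ 0`: `0 ≤ ĝ¹_K(q)` and
`(ĝ¹_K(q))² E^K_q ≤ ¼ Σᵢ Kᵢ (e₁^{(i)} - e₃^{(i)} cos qᵢ)`, `E^K_q = ΣᵢKᵢ(1 - cos qᵢ)` — KLS's
(6)–(7) for the model (5) (XY version, direction-resolved bond correlations), now unconditional
(Gaussian domination is the theorem `xyAniso_gaussianDomination_ground`).
[cite: KLS1988JSP, eqs. (5)–(7), p. 1026] [cite: KLS1988PRL, eq. (4)] -/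
theorem xyAniso_infraredBound_ground (hL : Even L) (h4 : 4 ≤ L) {K : Fin d → ℝ} (hK : ∀ i, 0 < K i)
    (q : TorusSite d L) (hq : q ≠ 0) :
    0 ≤ xyAnisoStructureFactor 0 L n K q ∧
      xyAnisoStructureFactor 0 L n K q ^ 2 * NVectorAniso.anisoDispersion K (latticeMomentum L q) ≤
        (1 / 4 : ℝ) * ∑ i, K i * (xyAnisoDirBondCorr 0 L n K i -
          xyAnisoDirBondCorr 2 L n K i * Real.cos (latticeMomentum L q i)) :=
  xyAniso_infraredBound_of_groundEnergy_le L n K (by omega)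
    (fun h => xyAniso_gaussianDomination_ground L n hL h4 (fun i => (hK i).le) h) q
    (anisoDispersion_latticeMomentum_pos L hK hq)

end Assembly

end Literature.MathematicalPhysics.QuantumLattice
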